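import Summits.QuantumFields.YangMills.Theorems.BalabanUVNodesN10AtRecord12
import Summits.QuantumFields.YangMills.Theorems.BalabanUVNodesN10RecordCensus

/-!
# BalabanUVNodes ∕ N10 AT THE STAGE-12 RECORD — THE SIDE FACES: WHY N10's KEY AT ₁₂ IS THE B13-RE-BOUND RECORD, NOT THE ROUTE's OWN `Rec`
# (Track A, DAG node N10 [Balaban1988RG2Cluster] Lemmas 1–3 pp. 9, 11, 20; seat `pub-ymgap-dag-n10-d` strategy s2; the `11 ↦ 12` re-key of
# `…N10AtRecord11Sides` (p454412); companion of `BalabanUVNodesN10AtRecord12`)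

HONEST FRAMING.  Count-neutral kernel bookkeeping BY NAME over LANDED modules: def-T's `Node00.Record12` (`IsRecordOfRecord₁₂C`), g32's `Record12Carriers`
(`Stage12Params.rebindX`), dag-p2's `…N10RecordCensus` (the generic swap test `not_s_N10_of_swapClosed`, the θ-level witness `exists_swap_inEdges_not_b13`,
both stated at a GENERIC `Stage5Params` and applied here at the Stage-12 view verbatim) and this seat's `…N10AtRecord12` (`exists_rebindX_of_isRecordOfRecord₁₂C`)
∕ `…N10AtRecord11` (the Stage-5 faces `b13_leaf_iff_rebindX`, `b13_main_iff_rebindX`).  WHY THE RE-KEY: the ₁₁ twin's hypothesis «one ₁₁C record somewhere»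
is REFUTED by def-T's `Node00.not_isRecordOfRecord₁₁C` (the ₁₁C class is empty), so `…N10AtRecord11Sides` §2–§3 are vacuous implications; the same census at
the Stage-12 record is the one that bears on the route's rev-8 cruxes.  Over the route's record predicate `Rec = Node00.IsRecordOfRecord₁₂C` the B13 group
`(θ.res.X P).S13 ∕ c13` — and the [B9] ∕ [B11] carriers the in-edges read — are STILL FREE residual fields of the Stage-12 view `θ.toStage5₁₂`; so, GIVEN ONE
₁₂C record anywhere (the route's K0′ as HYPOTHESIS, never asserted), the ∀-form `S_N10 (IsRecordOfRecord₁₂C · N)` is FALSE (§2) and the leaf `b13` ∕ the node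
`Dag.B13_main` are UNDETERMINED over the class (§3).  This is the ₁₂ instance of dag-p2's «every cumulative carrier-pinning record fails the S13-swap test until
the B13 group is itself pinned» — i.e. WHY the companion module keys N10 at the B13-RE-BOUND record (`s_N10_of_boundAtStage12RebindS13`, the shape a
`CarriersB13`-at-₁₂ record instantiates).  NO printed statement is refuted; nothing of Bałaban's is asserted; N10 NOT discharged; one finite T⁴ programme
at fixed ε; nothing continuum ∕ ℝ⁴ ∕ OS ∕ mass-gap ∕ Clay.  0 `sorry`, 0 `def`, standard axioms.  Filed `--supports` K1′ «StabilityBAtRecordR12e» (stmt-QuantumFields-19790) of route «BalabanUVNodes»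
(θ-keyed ∃-form: the prover CHOOSES the record — §2's refuted ∀-form over the bare class is the reason that currency is the right one for N10).

WHAT THIS FILE PROVES.  §1 the X∕Y∕Z re-binding of Stage-12 parameters (inline structure update; provisos ∕ admissibility ∕ view ∕ datum transport, `rfl`s at a
GENERIC re-binding per KERNEL LESSON 7), `isRecordOfRecord₁₂C_rebindXYZ`, `swapXYZ_of_isRecordOfRecord₁₂C` (₁₂C is CARRIER-SWAP CLOSED at the same datum);
§2 `not_s_N10_record₁₂C`, `not_flowBounds_record₁₂C` (given ₁₂C-inhabitation somewhere); §3 `exists_isRecordOfRecord₁₂C_b13_iff` (EVERY step-data family occurs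
as the B13 group of some ₁₂C record at the family, given one), `exists_isRecordOfRecord₁₂C_b13_main` ∕ `exists_isRecordOfRecord₁₂C_not_b13_main`,
`b13_main_undetermined_over_record₁₂C`.
-/

noncomputable section

namespace Summit.QuantumFields.YangMills.BalabanUVNodes.N10AtRecord12Sides

open Literature.MathematicalPhysics.QuantumFieldTheory.Balaban1983to89
open Literature.MathematicalPhysics.QuantumFieldTheory.Balaban1983to89.T4Continuum
open Literature.MathematicalPhysics.QuantumFieldTheory.Balaban1983to89.DagBinding
open Literature.MathematicalPhysics.QuantumFieldTheory.Balaban1983to89.Node00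
open YMDAG.UVSplit (RecordPred AtRecord S_N10 FlowBounds)
open Summit.QuantumFields.YangMills.BalabanUVNodes.N10AtRecord11 (b13_leaf_iff_rebindX b13_main_iff_rebindX)
open Summit.QuantumFields.YangMills.BalabanUVNodes.N10AtRecord12 (exists_rebindX_of_isRecordOfRecord₁₂C)
open Summit.QuantumFields.YangMills.Theorems.BalabanUVNodesN10RecordCensus (not_s_N10_of_swapClosed exists_swap_inEdges_not_b13)

variable {F : T4Family} {N : ℕ} [NeZero N]

/-! ## §1. The X∕Y∕Z re-binding of Stage-12 parameters: provisos, admissibility, the view and the datum do not read the carriers; ₁₂C is carrier-swap closed -/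

section RebindXYZ

variable (θ : Stage12Params F N) (X' : B12.RunParams → PrintedCarriersR) (Y' : B12.RunParams → PrintedCarriers9X) (Z' : B12.RunParams → PrintedCarriers11)

/-- The displayed Stage-12 provisos transport along ANY re-binding of the residual `X, Y, Z` families, field by field (the shape of g32's
`Stage12Params.Provisos₁₂.rebindX`: `base` rebuilt over the re-bound Stage-9 part, `rzLaws ∕ ztLaws ∕ ztLocal ∕ bg` verbatim — none reads a carrier).
[cite: Balaban1988Convergent, (3.2)–(3.9) pp.265–266, (2.23)–(2.42) pp.259–262 (the displayed provisos; bookkeeping)] -/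
theorem provisos₁₂_rebindXYZ (h : θ.Provisos₁₂ F N) :
    ({ θ with toStage9Params := { θ.toStage9Params with res := { θ.res with X := X', Y := Y', Z := Z' } } } : Stage12Params F N).Provisos₁₂ F N :=
  { h with
    base := ⟨h.base.intPiece, h.base.measω, h.base.measChi, h.base.zetaUnity, h.base.zetaAbs, fun p k _ hk => h.base.rstep p k hk, h.base.contT⟩ }

/-- Admissibility reads no carrier (`Iff.rfl`). [cite: Balaban1987RG1, (1.12) p.262; Balaban1988Convergent, (2.10) p.256, (2.34)–(2.39) p.261, (3.4) p.265 (hypothesis dictionary; bookkeeping)] -/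
theorem admissible₁₂_rebindXYZ_iff :
    ({ θ with toStage9Params := { θ.toStage9Params with res := { θ.res with X := X', Y := Y', Z := Z' } } } : Stage12Params F N).Admissible F N ↔
      θ.Admissible F N :=
  Iff.rfl

/-- The Stage-12 view of X∕Y∕Z-re-bound parameters IS the X∕Y∕Z-re-bound view (`rfl`: `residualOfStage12` keeps `X`, `Y`, `Z`).
[cite: Balaban1988Convergent, p.244 (bookkeeping)] -/
theorem toStage5₁₂_rebindXYZ :
    ({ θ with toStage9Params := { θ.toStage9Params with res := { θ.res with X := X', Y := Y', Z := Z' } } } : Stage12Params F N).toStage5₁₂ F N =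
      ({ θ.toStage5₁₂ F N with res := { (θ.toStage5₁₂ F N).res with X := X', Y := Y', Z := Z' } } : Stage5Params F N) :=
  rfl

/-- THE DATUM DOES NOT READ THE CARRIERS `X, Y, Z` (`rfl` at a generic re-binding). [cite: Balaban1989LargeFieldII, Thm 1 + (0.1) pp.355–356 (bookkeeping)] -/
theorem datumOfRecord₁₂_rebindXYZ (h : θ.Provisos₁₂ F N)
    (h' : ({ θ with toStage9Params := { θ.toStage9Params with res := { θ.res with X := X', Y := Y', Z := Z' } } } : Stage12Params F N).Provisos₁₂ F N) :
    datumOfRecord₁₂ F N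
        ({ θ with toStage9Params := { θ.toStage9Params with res := { θ.res with X := X', Y := Y', Z := Z' } } } : Stage12Params F N) h' =
      datumOfRecord₁₂ F N θ h :=
  rfl

/-- **Pointed form: a world bound at the C-binding over an X∕Y∕Z-RE-BOUND Stage-12 view is a Stage-12 record AT THE SAME DATUM.**
[cite: Balaban1989LargeFieldII, Thm 1 + (0.1) pp.355–356 (bookkeeping)] -/
theorem isRecordOfRecord₁₂C_rebindXYZ (h : θ.Provisos₁₂ F N) (hθ : θ.Admissible F N) (w : WorldP) (hC : w.C = (datumOfRecord₁₂ F N θ h).C)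
    (hγ : 0 < w.γ ∧ w.γ ≤ θ.γ) (hL : w.L = (θ.L : ℝ))
    (hup : ∀ P, w.up P =
      upOfRecord₅C F N ({ θ.toStage5₁₂ F N with res := { (θ.toStage5₁₂ F N).res with X := X', Y := Y', Z := Z' } } : Stage5Params F N) P) :
    IsRecordOfRecord₁₂C F N (datumOfRecord₁₂ F N θ h) w := by
  refine ⟨{ θ with toStage9Params := { θ.toStage9Params with res := { θ.res with X := X', Y := Y', Z := Z' } } },
    provisos₁₂_rebindXYZ θ X' Y' Z' h, (admissible₁₂_rebindXYZ_iff θ X' Y' Z').2 hθ, ?_, hC, hγ, hL, fun P => ?_⟩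
  · exact (datumOfRecord₁₂_rebindXYZ θ X' Y' Z' h (provisos₁₂_rebindXYZ θ X' Y' Z' h)).symm
  · exact (hup P).trans (congrArg (upOfRecord₅C F N · P) (toStage5₁₂_rebindXYZ θ X' Y' Z').symm)

end RebindXYZ

/-- **THE ROUTE's `Rec = IsRecordOfRecord₁₂C` IS CARRIER-SWAP CLOSED AT THE SAME DATUM**: every ₁₂C record's world is bound over the Stage-5 view `θ.toStage5₁₂` of its
parameters, and re-binding it over that view with ANY residual families `X′, Y′, Z′` is again a ₁₂C record of the SAME `D` — the hypothesis `hswap` of dag-p2's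
generic test `…N10RecordCensus.not_s_N10_of_swapClosed`. [cite: Balaban1989LargeFieldII, Thm 1 + (0.1) pp.355–356 (bookkeeping)] -/
theorem swapXYZ_of_isRecordOfRecord₁₂C {D : FiniteEpsData F (SU N)} {w : WorldP} (hR : IsRecordOfRecord₁₂C F N D w) :
    ∃ θ₅ : Stage5Params F N, (∀ P, w.up P = upOfRecord₅C F N θ₅ P) ∧
      ∀ (X' : B12.RunParams → PrintedCarriersR) (Y' : B12.RunParams → PrintedCarriers9X) (Z' : B12.RunParams → PrintedCarriers11),
        IsRecordOfRecord₁₂C F N D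
          { w with up := fun P => upOfRecord₅C F N ({ θ₅ with res := { θ₅.res with X := X', Y := Y', Z := Z' } } : Stage5Params F N) P } := by
  obtain ⟨θ, hP, hθ, hD, hC, hγ, hL, hup⟩ := hR
  refine ⟨θ.toStage5₁₂ F N, hup, fun X' Y' Z' => ?_⟩
  rw [hD]
  exact isRecordOfRecord₁₂C_rebindXYZ θ X' Y' Z' hP hθ _ (by rw [← hD]; exact hC) hγ hL fun _ => rfl

/-! ## §2. The ∀-form of N10 over the route's own `Rec` is FALSE (given one ₁₂C record anywhere) -/

/-- **`S_N10 (IsRecordOfRecord₁₂C · N)` IS FALSE AS SOON AS THE ₁₂C CLASS IS INHABITED ON SOME FAMILY** (the route's K0′ somewhere, as HYPOTHESIS): dag-p2's generic test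
`not_s_N10_of_swapClosed` at the swap closure of §1 — at some ₁₂C record every in-edge leaf `b9 b10 b11 b12` holds and `b13` fails at every run.  What this says:
N10's closer over the route's `Rec` must be keyed at a B13-PINNED record (`N10AtRecord12.s_N10_of_boundAtStage12RebindS13`), exactly as N08's is keyed at the [B10]-pinned one.
[cite: Balaban1988RG2Cluster, Lemmas 1–3 pp.9, 11, 20 (bookkeeping: the universal form over the unpinned Stage-12 record is refutable)] -/
theorem not_s_N10_record₁₂C (hK0 : ∃ (F : T4Family) (D : FiniteEpsData F (SU N)) (w : WorldP), IsRecordOfRecord₁₂C F N D w) :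
    ¬ S_N10 (fun F D w => IsRecordOfRecord₁₂C F N D w) :=
  not_s_N10_of_swapClosed N _ hK0 fun F D w hR => by
    obtain ⟨θ₅, -, hsw⟩ := swapXYZ_of_isRecordOfRecord₁₂C hR
    exact ⟨θ₅, fun X' Y' Z' => ⟨D, hsw X' Y' Z'⟩⟩

/-- **K1's cluster statement «FlowBounds» over the route's own `Rec` is FALSE** (its N10 conjunct is), given ₁₂C-inhabitation somewhere.
[cite: Balaban1988RG2Cluster, Lemmas 1–3 pp.9, 11, 20 (bookkeeping over the route's cluster statement)] -/
theorem not_flowBounds_record₁₂C (hK0 : ∃ (F : T4Family) (D : FiniteEpsData F (SU N)) (w : WorldP), IsRecordOfRecord₁₂C F N D w) :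
    ¬ FlowBounds (fun F D w => IsRecordOfRecord₁₂C F N D w) :=
  fun h => not_s_N10_record₁₂C hK0 fun F D w hR P => (h F D w hR P).2.2.1

/-! ## §3. The leaf `b13` and the node are UNDETERMINED over the ₁₂C class (given one ₁₂C record at the family) -/

/-- **EVERY STEP-DATA FAMILY OCCURS AS THE B13 GROUP OF SOME ₁₂C RECORD AT THE FAMILY, GIVEN ONE**: the SAME datum with the world B13-re-bound to `(S, c)`
(`N10AtRecord12.exists_rebindX_of_isRecordOfRecord₁₂C`), at every run of which `b13` IS the triple of `(S P, c)`.  A probe of the TYPING, not a statement about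
Bałaban's step. [cite: Balaban1988RG2Cluster, Lemma 1 p.9, Lemma 2 p.11, Lemma 3 p.20 (typed leaf over the residual group; bookkeeping)] -/
theorem exists_isRecordOfRecord₁₂C_b13_iff (hK0 : ∃ (D : FiniteEpsData F (SU N)) (w : WorldP), IsRecordOfRecord₁₂C F N D w)
    (S : B12.RunParams → B13.StepData) (c : B13.Consts) :
    ∃ (D : FiniteEpsData F (SU N)) (w : WorldP), IsRecordOfRecord₁₂C F N D w ∧
      ∀ P : B12.RunParams, ((leavesP w P).b13 ↔ B13.Lemma1Printed (S P) c ∧ B13.Lemma2Printed (S P) c ∧ B13.Lemma3Printed (S P) c) := by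
  obtain ⟨D, w, hR⟩ := hK0
  let X13 : Stage12Params F N → B12.RunParams → PrintedCarriersR := fun θ P => { θ.res.X P with S13 := S P, c13 := c }
  obtain ⟨θ, -, -, -, -, hR'⟩ := exists_rebindX_of_isRecordOfRecord₁₂C hR X13
  exact ⟨D, _, hR', fun P => b13_leaf_iff_rebindX F N (θ.toStage5₁₂ F N) (X13 θ) _ P rfl⟩

/-- **At some ₁₂C record (given one at the family) N10 HOLDS AT EVERY RUN — DEGENERATELY**: the B13 group re-bound to the EMPTY step data of dag-p2's
`B13ResidualSlotProbe.exists_stepData_b13Triple` (Lemmas 1–3 vacuous as typed; REUSED by name). [cite: Balaban1988RG2Cluster, Lemmas 1–3 pp.9, 11, 20 (typing; bookkeeping witness)] -/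
theorem exists_isRecordOfRecord₁₂C_b13_main (hK0 : ∃ (D : FiniteEpsData F (SU N)) (w : WorldP), IsRecordOfRecord₁₂C F N D w) :
    ∃ (D : FiniteEpsData F (SU N)) (w : WorldP), IsRecordOfRecord₁₂C F N D w ∧ ∀ P : B12.RunParams, Dag.B13_main (leavesP w P) := by
  obtain ⟨D, w, hR⟩ := hK0
  obtain ⟨Sj, hSj⟩ := B13ResidualSlotProbe.exists_stepData_b13Triple
  obtain ⟨θ, -, -, -, -, hR'⟩ := exists_rebindX_of_isRecordOfRecord₁₂C hR fun θ P => { θ.res.X P with S13 := Sj }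
  exact ⟨D, _, hR', fun P =>
    (b13_main_iff_rebindX F N (θ.toStage5₁₂ F N) (fun P => { θ.res.X P with S13 := Sj }) _ P rfl).2 fun _ _ _ _ => hSj _⟩

/-- **At some ₁₂C record (given one at the family) N10 FAILS AT EVERY RUN**: the residual `X, Y, Z` swapped to dag-p2's θ-level witness (`exists_swap_inEdges_not_b13`:
in-edges `b9 b10 b11 b12` true, `b13` false) — a ₁₂C record by §1. [cite: Balaban1988RG2Cluster, Lemmas 1–3 pp.9, 11, 20; p.1 (in-edges) (bookkeeping witness)] -/
theorem exists_isRecordOfRecord₁₂C_not_b13_main (hK0 : ∃ (D : FiniteEpsData F (SU N)) (w : WorldP), IsRecordOfRecord₁₂C F N D w) :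
    ∃ (D : FiniteEpsData F (SU N)) (w : WorldP), IsRecordOfRecord₁₂C F N D w ∧ ∀ P : B12.RunParams, ¬ Dag.B13_main (leavesP w P) := by
  obtain ⟨D, w, hR⟩ := hK0
  obtain ⟨θ₅, -, hsw⟩ := swapXYZ_of_isRecordOfRecord₁₂C hR
  obtain ⟨X', Y', Z', hw⟩ := exists_swap_inEdges_not_b13 N θ₅
  refine ⟨D, _, hsw X' Y' Z', fun P h => ?_⟩
  have hl := hw { w with up := fun P => upOfRecord₅C F N ({ θ₅ with res := { θ₅.res with X := X', Y := Y', Z := Z' } } : Stage5Params F N) P }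
    P rfl
  exact hl.2.2.2.2 (h hl.1 hl.2.1 hl.2.2.1 hl.2.2.2.1)

/-- **N10 IS UNDETERMINED OVER THE ROUTE's `Rec` AT STAGE 12** (given one ₁₂C record at the family): some record has `Dag.B13_main` at every run, some has its negation
at every run — the B13 group is residual free data of `θ.toStage5₁₂`; the pin (`CarriersB13` at ₁₂) is what makes the node a statement about Bałaban's step.
[cite: Balaban1988RG2Cluster, Lemmas 1–3 pp.9, 11, 20 (bookkeeping: census of the typed node over the unpinned Stage-12 record)] -/
theorem b13_main_undetermined_over_record₁₂C (hK0 : ∃ (D : FiniteEpsData F (SU N)) (w : WorldP), IsRecordOfRecord₁₂C F N D w) :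
    (∃ (D : FiniteEpsData F (SU N)) (w : WorldP), IsRecordOfRecord₁₂C F N D w ∧ ∀ P : B12.RunParams, Dag.B13_main (leavesP w P)) ∧
      ∃ (D : FiniteEpsData F (SU N)) (w : WorldP), IsRecordOfRecord₁₂C F N D w ∧ ∀ P : B12.RunParams, ¬ Dag.B13_main (leavesP w P) :=
  ⟨exists_isRecordOfRecord₁₂C_b13_main hK0, exists_isRecordOfRecord₁₂C_not_b13_main hK0⟩

end Summit.QuantumFields.YangMills.BalabanUVNodes.N10AtRecord12Sides

end
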